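import Mathlib
import Literature.NumberTheory.Transcendental.KZCalculus
import Literature.NumberTheory.Transcendental.SemialgebraicMaps

/-!
# Crux idea `weil-locus-liouville-transport` — first lemma (crux-ideate round 2, ideator 5)

Crux: `TerasomaMultiplication.GammaHodgeSector` (= `MotivatedMoves.GammaHodgeSector`), item
stmt-KontsevichZagierPeriods-3742.

The lever is Deligne's Principle B (LNM 900, Thm 2.12/2.15, §4 Thm 4.8, §5 (c)) read as ONE
Newton–Leibniz move in the modulus: along a real-algebraic arc of a family of curves whose
Jacobians carry an `O_F`-action of Weil signature, the `F`-DETERMINANT of the period matrix,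
divided by its Liouville gauge `g` (`g' = tr(A)·g`, `A` the Gauss–Manin matrix of the block), is
constant; the constancy is `∂ₛ(det/g) = Σᵢ ∂_{xᵢ}(…)` (Jacobi's formula + the Picard–Fuchs
certificates), i.e. one `newtonLeibnizRel` in `s` plus `d` box-Stokes instances.

`LiouvilleDeterminantTransport d` below is the abstract calculus statement (the `d = 2` case is
Legendre-shaped: compare `GaussManinCertificates.LegendreModulusPropagation`). It is stated over
the tree's `KZ.IntegralRep` / `KZ.Equivalent` / `IsSemialgebraicFunOn` only.
-/

open scoped BigOperators
open Set

namespace Summit.KontsevichZagierPeriods.KontsevichZagierPeriods.Cruxes.GammaHodgeSector.WeilLocusTransport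

open Literature.NumberTheory.Transcendental
open Literature.NumberTheory.Transcendental.KZ

/-- The open unit cube `(0,1)^d`. -/
def cube (d : ℕ) : Set (Fin d → ℝ) := {p | ∀ i, p i ∈ Ioo (0:ℝ) 1}

/-- The closed slab `[0,1] × [s₀,s₁] ⊂ ℝ²` in coordinates `(x, s)`. -/
def slab (s₀ s₁ : ℝ) : Set (Fin 2 → ℝ) := {z | z 0 ∈ Icc (0:ℝ) 1 ∧ z 1 ∈ Icc s₀ s₁}

/-- The parameter segment `[s₀,s₁] ⊂ ℝ¹`. -/
def seg (s₀ s₁ : ℝ) : Set (Fin 1 → ℝ) := {z | z 0 ∈ Icc s₀ s₁}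

/-- The determinant integrand at parameter `s`: `p ↦ det [F i j (p i) s]_{i,j} / g s`
(row `i` = the `i`-th arc, carried by the variable `p i`; column `j` = the `j`-th form). -/
noncomputable def detIntegrand (d : ℕ) (F : Fin d → Fin d → ℝ → ℝ → ℝ) (g : ℝ → ℝ) (s : ℝ)
    (p : Fin d → ℝ) : ℝ :=
  (Matrix.of fun i j => F i j (p i) s).det / g s

/-- **Liouville determinant transport (rank `d`).**  Data: a `d × d` array of functions
`F i j (x, s)` ("form `j` on arc `i`", each arc parametrised by `x ∈ (0,1)`), jointly
`ℚ`-semialgebraic on the slab; a Gauss–Manin certificate `∂ₛ F i j = Σ_k A j k · F i k + ∂ₓ G i j`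
with `G i j (·, s) → 0` at both ends of the arc; and a positive gauge `g` with `g' = tr(A)·g`.
Conclusion: the determinant representations `[(0,1)^d, det(F(·,s))/g(s)]` at two real-algebraic
parameters `s₀ < s₁` are `KZ.Equivalent`.  (Jacobi: `∂ₛ(det/g) = Σᵢ ∂_{pᵢ}((-1)^{i+j} G i j · minor)`,
the `A`-part being `tr(A)·det` which the gauge absorbs; then one Newton–Leibniz move in `s` on
`(0,1)^d × [s₀,s₁]` and `d` instances of box-Stokes.) -/
def LiouvilleDeterminantTransport (d : ℕ) : Prop :=
  ∀ (s₀ s₁ : ℝ) (F G : Fin d → Fin d → ℝ → ℝ → ℝ) (A : Fin d → Fin d → ℝ → ℝ) (g : ℝ → ℝ),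
    s₀ < s₁ → IsAlgebraic ℚ s₀ → IsAlgebraic ℚ s₁ →
    (∀ i j, IsSemialgebraicFunOn ℚ (slab s₀ s₁) (fun z => F i j (z 0) (z 1))) →
    (∀ i j, IsSemialgebraicFunOn ℚ (slab s₀ s₁) (fun z => G i j (z 0) (z 1))) →
    (∀ j k, IsSemialgebraicFunOn ℚ (seg s₀ s₁) (fun z => A j k (z 0))) →
    IsSemialgebraicFunOn ℚ (seg s₀ s₁) (fun z => g (z 0)) →
    (∀ i j, ContinuousOn (fun q : ℝ × ℝ => F i j q.1 q.2) (Ioo (0:ℝ) 1 ×ˢ Icc s₀ s₁)) →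
    (∀ i j (x s : ℝ), x ∈ Ioo (0:ℝ) 1 → s ∈ Ioo s₀ s₁ →
      HasDerivAt (fun σ => F i j x σ)
        ((∑ k, A j k s * F i k x s) + deriv (fun ξ => G i j ξ s) x) s) →
    (∀ i j (s : ℝ), s ∈ Icc s₀ s₁ →
      DifferentiableOn ℝ (fun ξ => G i j ξ s) (Ioo (0:ℝ) 1) ∧
      Filter.Tendsto (fun ξ => G i j ξ s) (nhdsWithin 0 (Ioi 0)) (nhds 0) ∧
      Filter.Tendsto (fun ξ => G i j ξ s) (nhdsWithin 1 (Iio 1)) (nhds 0)) →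
    (∀ s ∈ Icc s₀ s₁, 0 < g s ∧ HasDerivAt g ((∑ j, A j j s) * g s) s) →
    (∀ s ∈ Icc s₀ s₁, MeasureTheory.IntegrableOn (detIntegrand d F g s) (cube d)) →
    MeasureTheory.IntegrableOn
      (fun z : Fin (d + 1) → ℝ => deriv (fun σ => detIntegrand d F g σ (Fin.init z)) (z (Fin.last d)))
      {z | Fin.init z ∈ cube d ∧ z (Fin.last d) ∈ Icc s₀ s₁} →
    ∀ (r₀ r₁ : IntegralRep d),
      r₀.domain = cube d → r₁.domain = cube d →
      EqOn r₀.integrand (detIntegrand d F g s₀) r₀.domain →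
      EqOn r₁.integrand (detIntegrand d F g s₁) r₁.domain →
      Equivalent r₀ r₁

/-- The rank-2 case, spelled out without `Matrix.det` (Legendre-shaped). -/
def LiouvilleTransportTwo : Prop :=
  ∀ (s₀ s₁ : ℝ) (F G : Fin 2 → Fin 2 → ℝ → ℝ → ℝ) (A : Fin 2 → Fin 2 → ℝ → ℝ) (g : ℝ → ℝ),
    s₀ < s₁ → IsAlgebraic ℚ s₀ → IsAlgebraic ℚ s₁ →
    (∀ i j, IsSemialgebraicFunOn ℚ (slab s₀ s₁) (fun z => F i j (z 0) (z 1))) →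
    (∀ i j, IsSemialgebraicFunOn ℚ (slab s₀ s₁) (fun z => G i j (z 0) (z 1))) →
    (∀ j k, IsSemialgebraicFunOn ℚ (seg s₀ s₁) (fun z => A j k (z 0))) →
    IsSemialgebraicFunOn ℚ (seg s₀ s₁) (fun z => g (z 0)) →
    (∀ i j, ContinuousOn (fun q : ℝ × ℝ => F i j q.1 q.2) (Ioo (0:ℝ) 1 ×ˢ Icc s₀ s₁)) →
    (∀ i j (x s : ℝ), x ∈ Ioo (0:ℝ) 1 → s ∈ Ioo s₀ s₁ →
      HasDerivAt (fun σ => F i j x σ)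
        ((∑ k, A j k s * F i k x s) + deriv (fun ξ => G i j ξ s) x) s) →
    (∀ i j (s : ℝ), s ∈ Icc s₀ s₁ →
      DifferentiableOn ℝ (fun ξ => G i j ξ s) (Ioo (0:ℝ) 1) ∧
      Filter.Tendsto (fun ξ => G i j ξ s) (nhdsWithin 0 (Ioi 0)) (nhds 0) ∧
      Filter.Tendsto (fun ξ => G i j ξ s) (nhdsWithin 1 (Iio 1)) (nhds 0)) →
    (∀ s ∈ Icc s₀ s₁, 0 < g s ∧ HasDerivAt g ((A 0 0 s + A 1 1 s) * g s) s) →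
    (∀ s ∈ Icc s₀ s₁, MeasureTheory.IntegrableOn
      (fun p : Fin 2 → ℝ => (F 0 0 (p 0) s * F 1 1 (p 1) s - F 0 1 (p 0) s * F 1 0 (p 1) s) / g s)
      (cube 2)) →
    ∀ (r₀ r₁ : IntegralRep 2),
      r₀.domain = cube 2 → r₁.domain = cube 2 →
      EqOn r₀.integrand
        (fun p => (F 0 0 (p 0) s₀ * F 1 1 (p 1) s₀ - F 0 1 (p 0) s₀ * F 1 0 (p 1) s₀) / g s₀) r₀.domain →
      EqOn r₁.integrand
        (fun p => (F 0 0 (p 0) s₁ * F 1 1 (p 1) s₁ - F 0 1 (p 0) s₁ * F 1 0 (p 1) s₁) / g s₁) r₁.domain →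
      Equivalent r₀ r₁

/-- Sanity: the `2 × 2` determinant integrand is the spelled-out one. -/
theorem detIntegrand_two (F : Fin 2 → Fin 2 → ℝ → ℝ → ℝ) (g : ℝ → ℝ) (s : ℝ) (p : Fin 2 → ℝ) :
    detIntegrand 2 F g s p =
      (F 0 0 (p 0) s * F 1 1 (p 1) s - F 0 1 (p 0) s * F 1 0 (p 1) s) / g s := by
  simp [detIntegrand, Matrix.det_fin_two, Matrix.of_apply]

/-- Jacobi's divergence identity behind the transport, in rank 2 and pointwise (pure calculus, no
KZ objects): if the columns move by `A` plus `x`-derivatives of `G`, and `g' = tr(A) g`, then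
`∂ₛ(det/g)` is the sum of an `x`-derivative and a `y`-derivative.  Stated as a `Prop` (the first
thing a prover would discharge). -/
def JacobiDivergenceTwo : Prop :=
  ∀ (F G : Fin 2 → Fin 2 → ℝ → ℝ → ℝ) (A : Fin 2 → Fin 2 → ℝ → ℝ) (g : ℝ → ℝ) (x y s : ℝ),
    (∀ i j, HasDerivAt (fun σ => F i j (if i = 0 then x else y) σ)
        ((∑ k, A j k s * F i k (if i = 0 then x else y) s)
          + deriv (fun ξ => G i j ξ s) (if i = 0 then x else y)) s) →
    g s ≠ 0 → HasDerivAt g ((A 0 0 s + A 1 1 s) * g s) s →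
    HasDerivAt (fun σ => (F 0 0 x σ * F 1 1 y σ - F 0 1 x σ * F 1 0 y σ) / g σ)
      ((deriv (fun ξ => G 0 0 ξ s) x * F 1 1 y s - deriv (fun ξ => G 0 1 ξ s) x * F 1 0 y s
        + F 0 0 x s * deriv (fun η => G 1 1 η s) y - F 0 1 x s * deriv (fun η => G 1 0 η s) y)
        / g s) s

end Summit.KontsevichZagierPeriods.KontsevichZagierPeriods.Cruxes.GammaHodgeSector.WeilLocusTransport
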